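import Literature.NumberTheory.Automorphic.LevelActionHeckeRestriction
import Literature.NumberTheory.Automorphic.LevelActionInducedRegular
import HarnessLib

/-!
# The transfer commutes with Hecke operators given a common family of representatives

Topic `NumberTheory/Automorphic`; namespace `Literature.NumberTheory.Automorphic.LevelAction`;
theorems only (no new definitions, no named fact, no `sorry`).  Universe `0`.

For levels `U ≤ U' ⊆ Δ`, a transversal `S` of `U'/U`, an element `α ∈ Δ` and a finite family of
representatives `α_j ∈ Δ` enumerating BOTH `UαU/U` and `U'αU'/U'`:

* `bijOn_quotientMapOfLE_of_bijOn` — the projection `UαU/U → U'αU'/U'` is then a bijection, which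
  is the hypothesis under which `res` commutes with `[· α ·]` (`LevelActionHeckeRestriction`);
* **`heckeOp₂_one_heckeOp_comm`** — if moreover every `s ∈ S` permutes the cosets `α_j U` in the
  sense `s α_j U = α_{σ_s j} s U` (e.g. `s` commutes with the `α_j`, or the unipotent/diagonal
  commutation rule at `p`), then `[U' 1 U] ∘ [UαU] = [U'αU'] ∘ [U' 1 U]` on `M^U`; hence
  **`trRepHom`/`trCohomology` commute with the Hecke operators** (`heckeRepHom_comp_trRepHom`,
  `trCohomology_comp_heckeCohomology`).

[cite: Hida1994AIF, §2 (compatibility of [U' 1 U] with T(p) and T(l))] [cite: ShimuraIATAF1971, Ch. 3 §3.1]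

## References

* H. Hida, Ann. Inst. Fourier 44 (1994), §2. [Hida1994AIF]
* G. Shimura, *Introduction to the arithmetic theory of automorphic functions* (1971), Ch. 3.
  [ShimuraIATAF1971]
-/

noncomputable section

open CategoryTheory

namespace Literature.NumberTheory.Automorphic

namespace LevelAction

/-! ### Common representatives -/

section Cosets

variable {𝒢 : Type} [Group 𝒢] {U U' : Subgroup 𝒢}

/-- **A common family of representatives makes `UαU/U → U'αU'/U'` bijective.** [folklore] -/
theorem bijOn_quotientMapOfLE_of_bijOn (hle : U ≤ U') {α : 𝒢} {J : Type} (a : J → 𝒢)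
    (hbij : Set.BijOn (fun j => ((a j : 𝒢) : 𝒢 ⧸ U)) Set.univ (ArithmeticQuotient.doubleCosetQuot U α))
    (hbij' : Set.BijOn (fun j => ((a j : 𝒢) : 𝒢 ⧸ U')) Set.univ (ArithmeticQuotient.doubleCosetQuot U' α)) :
    Set.BijOn (Subgroup.quotientMapOfLE hle) (ArithmeticQuotient.doubleCosetQuot U α)
      (ArithmeticQuotient.doubleCosetQuot U' α) := by
  refine ⟨fun d hd => ?_, fun d₁ hd₁ d₂ hd₂ h => ?_, fun d' hd' => ?_⟩
  · obtain ⟨j, -, rfl⟩ := hbij.surjOn hd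
    exact hbij'.mapsTo (Set.mem_univ j)
  · obtain ⟨j₁, -, rfl⟩ := hbij.surjOn hd₁
    obtain ⟨j₂, -, rfl⟩ := hbij.surjOn hd₂
    have h12 : j₁ = j₂ := hbij'.injOn (Set.mem_univ _) (Set.mem_univ _) h
    rw [h12]
  · obtain ⟨j, -, rfl⟩ := hbij'.surjOn hd'
    exact ⟨_, hbij.mapsTo (Set.mem_univ j), rfl⟩

end Cosets

/-! ### `[U' 1 U]` commutes with `[· α ·]` -/

section Abstract

variable {R : Type} [CommRing R] {𝒢 : Type} [Group 𝒢] {M : Type} [AddCommGroup M]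
  [Module R M] {Δ : Submonoid 𝒢} {θ : Δ →* Module.End R M} {U U' : Subgroup 𝒢}

/-- **`[U' 1 U] ([UαU] m) = [U'αU'] ([U' 1 U] m)` on `m ∈ M^U`**, for a transversal `S` of `U'/U`,
a common family `α_j` of representatives of `UαU/U` and `U'αU'/U'`, and index maps `σ_s` with
`s α_j U = α_{σ_s j} s U` (`s ∈ S`). [cite: Hida1994AIF, §2] -/
theorem heckeOp₂_one_heckeOp_comm (hU : U.toSubmonoid ≤ Δ) (hU' : U'.toSubmonoid ≤ Δ) (hle : U ≤ U')
    {S : Finset 𝒢} (hS : Set.BijOn (fun s : 𝒢 => (s : 𝒢 ⧸ U)) S (ArithmeticQuotient.doubleCosetQuot₂ U' U 1))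
    {α : 𝒢} {J : Type} [Fintype J] (a : J → 𝒢) (haΔ : ∀ j, a j ∈ Δ)
    (hbij : Set.BijOn (fun j => ((a j : 𝒢) : 𝒢 ⧸ U)) Set.univ (ArithmeticQuotient.doubleCosetQuot U α))
    (hbij' : Set.BijOn (fun j => ((a j : 𝒢) : 𝒢 ⧸ U')) Set.univ (ArithmeticQuotient.doubleCosetQuot U' α))
    (σ : 𝒢 → J → J) (hσ : ∀ s ∈ S, ∀ j, ((s * a j : 𝒢) : 𝒢 ⧸ U) = ((a (σ s j) * s : 𝒢) : 𝒢 ⧸ U))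
    {m : M} (hm : m ∈ invariants Δ θ U) :
    heckeOp₂ Δ θ U' U 1 (heckeOp Δ θ U α m) = heckeOp Δ θ U' α (heckeOp₂ Δ θ U' U 1 m) := by
  classical
  have hα : α ∈ Δ := by
    obtain ⟨j, -, hj⟩ := hbij.surjOn (MulAction.mem_orbit_self (α : 𝒢 ⧸ U))
    obtain ⟨u, hu⟩ : ∃ u : U, (a j : 𝒢) * u = α := by
      have h := QuotientGroup.eq.1 hj
      exact ⟨⟨_, h⟩, by rw [Subgroup.coe_mk, mul_inv_cancel_left]⟩
    rw [← hu]
    exact Δ.mul_mem (haΔ j) (hU u.2)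
  have hS' : ∀ s ∈ S, s ∈ U' := fun s hs => ArithmeticQuotient.mem_of_bijOn hle hS hs
  -- left-hand side: `∑_s ∑_j act(s α_j) m`
  rw [heckeOp₂_one_apply_eq_sum hU hU' hle hS (heckeOp_apply_mem hU hα hm),
    heckeOp_apply_eq_sum_of_bijOn hU hm a haΔ hbij]
  -- right-hand side: `∑_j ∑_s act(α_j s) m`
  rw [heckeOp_apply_eq_sum_of_bijOn hU' (heckeOp₂_apply_mem hU' hU Δ.one_mem hm) a haΔ hbij',
    heckeOp₂_one_apply_eq_sum hU hU' hle hS hm]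
  simp only [map_sum]
  -- per `s ∈ S`: `∑_j act s (act α_j m) = ∑_j act (α_{σ j} s) m = ∑_j act (α_j s) m`
  have hL : ∀ s ∈ S, ∑ j, act Δ θ s (act Δ θ (a j) m) = ∑ j, act Δ θ (a j * s) m := fun s hs => by
    have hsΔ : s ∈ Δ := hU' (hS' s hs)
    have hterm : ∀ j, act Δ θ s (act Δ θ (a j) m) = act Δ θ (a (σ s j) * s) m := fun j => by
      rw [← Module.End.mul_apply, ← act_mul hsΔ (haΔ j)]
      obtain ⟨u, hu⟩ : ∃ u : U, a (σ s j) * s * u = s * a j := by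
        have h := QuotientGroup.eq.1 (hσ s hs j).symm
        exact ⟨⟨_, h⟩, by rw [Subgroup.coe_mk, mul_inv_cancel_left]⟩
      rw [← hu, act_mul_apply_of_mem_invariants hU hm (Δ.mul_mem (haΔ _) hsΔ) u.2]
    have hinj : Function.Injective (σ s) := fun j₁ j₂ h => by
      have h1 := hσ s hs j₁
      have h2 := hσ s hs j₂
      rw [h, ← h2] at h1
      have h3 : ((a j₁ : 𝒢) : 𝒢 ⧸ U) = ((a j₂ : 𝒢) : 𝒢 ⧸ U) := by
        rw [QuotientGroup.eq] at h1 ⊢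
        simpa [mul_inv_rev, mul_assoc] using h1
      exact hbij.injOn (Set.mem_univ _) (Set.mem_univ _) h3
    have hbijσ : Function.Bijective (σ s) := (Finite.injective_iff_bijective).1 hinj
    simp_rw [hterm]
    exact (Equiv.ofBijective _ hbijσ).sum_comp fun j => act Δ θ (a j * s) m
  rw [Finset.sum_congr rfl hL, Finset.sum_comm]
  refine Finset.sum_congr rfl fun j _ => Finset.sum_congr rfl fun s hs => ?_
  rw [act_mul (haΔ j) (hU' (hS' s hs)), Module.End.mul_apply]

end Abstract

/-! ### On sections and on cohomology -/

section Cohomology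

variable {R : Type} [CommRing R] {Γ 𝒢 : Type} [Group Γ] [Group 𝒢] (ι : Γ →* 𝒢) (Δ : Submonoid 𝒢)
  {V : Type} [AddCommGroup V] [Module R V] (τ : Δ →* Module.End R V) {U U' : Subgroup 𝒢}
  (hU : U.toSubmonoid ≤ Δ) (hU' : U'.toSubmonoid ≤ Δ)

/-- **`[UαU] ≫ tr = tr ≫ [U'αU']` as morphisms of `Γ`-representations** (common representatives and
index maps `σ_s` as in `heckeOp₂_one_heckeOp_comm`). [cite: Hida1994AIF, §2] -/
theorem heckeRepHom_comp_trRepHom (hle : U ≤ U')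
    {S : Finset 𝒢} (hS : Set.BijOn (fun s : 𝒢 => (s : 𝒢 ⧸ U)) S (ArithmeticQuotient.doubleCosetQuot₂ U' U 1))
    {α : 𝒢} (hα : α ∈ Δ) {J : Type} [Fintype J] (a : J → 𝒢) (haΔ : ∀ j, a j ∈ Δ)
    (hbij : Set.BijOn (fun j => ((a j : 𝒢) : 𝒢 ⧸ U)) Set.univ (ArithmeticQuotient.doubleCosetQuot U α))
    (hbij' : Set.BijOn (fun j => ((a j : 𝒢) : 𝒢 ⧸ U')) Set.univ (ArithmeticQuotient.doubleCosetQuot U' α))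
    (σ : 𝒢 → J → J) (hσ : ∀ s ∈ S, ∀ j, ((s * a j : 𝒢) : 𝒢 ⧸ U) = ((a (σ s j) * s : 𝒢) : 𝒢 ⧸ U)) :
    heckeRepHom ι Δ τ U hU hα ≫ trRepHom ι Δ τ hU hU' = trRepHom ι Δ τ hU hU' ≫ heckeRepHom ι Δ τ U' hU' hα := by
  refine Rep.hom_ext (Representation.IntertwiningMap.ext (LinearMap.ext fun f => ?_))
  change (trRepHom ι Δ τ hU hU').hom ((heckeRepHom ι Δ τ U hU hα).hom f) =
    (heckeRepHom ι Δ τ U' hU' hα).hom ((trRepHom ι Δ τ hU hU').hom f)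
  refine Subtype.ext ?_
  rw [trRepHom_hom_apply_coe, heckeRepHom_hom_apply_coe, heckeRepHom_hom_apply_coe, trRepHom_hom_apply_coe]
  exact heckeOp₂_one_heckeOp_comm hU hU' hle hS a haΔ hbij hbij' σ hσ f.2

/-- **`tr ∘ [UαU] = [U'αU'] ∘ tr` on `H^i`.** [cite: Hida1994AIF, §2] -/
theorem trCohomology_comp_heckeCohomology (hle : U ≤ U')
    {S : Finset 𝒢} (hS : Set.BijOn (fun s : 𝒢 => (s : 𝒢 ⧸ U)) S (ArithmeticQuotient.doubleCosetQuot₂ U' U 1))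
    {α : 𝒢} (hα : α ∈ Δ) {J : Type} [Fintype J] (a : J → 𝒢) (haΔ : ∀ j, a j ∈ Δ)
    (hbij : Set.BijOn (fun j => ((a j : 𝒢) : 𝒢 ⧸ U)) Set.univ (ArithmeticQuotient.doubleCosetQuot U α))
    (hbij' : Set.BijOn (fun j => ((a j : 𝒢) : 𝒢 ⧸ U')) Set.univ (ArithmeticQuotient.doubleCosetQuot U' α))
    (σ : 𝒢 → J → J) (hσ : ∀ s ∈ S, ∀ j, ((s * a j : 𝒢) : 𝒢 ⧸ U) = ((a (σ s j) * s : 𝒢) : 𝒢 ⧸ U))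
    (i : ℕ) :
    (trCohomology ι Δ τ hU hU' i).hom ∘ₗ heckeCohomology ι Δ τ U hU hα i =
      heckeCohomology ι Δ τ U' hU' hα i ∘ₗ (trCohomology ι Δ τ hU hU' i).hom := by
  dsimp only [trCohomology, heckeCohomology]
  rw [← ModuleCat.hom_comp, ← ModuleCat.hom_comp, ← groupCohomology.map_id_comp,
    ← groupCohomology.map_id_comp, heckeRepHom_comp_trRepHom ι Δ τ hU hU' hle hS hα a haΔ hbij hbij' σ hσ]

/-- **`res ∘ [U'αU'] = [UαU] ∘ res` on `H^i`, given a common family of representatives.**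
[cite: KhareThorne2017, §6.2, Lemma 6.5 (2)] -/
theorem resCohomology_comp_heckeCohomology_of_bijOn (hle : U ≤ U') {α : 𝒢} (hα : α ∈ Δ) {J : Type} (a : J → 𝒢)
    (hbij : Set.BijOn (fun j => ((a j : 𝒢) : 𝒢 ⧸ U)) Set.univ (ArithmeticQuotient.doubleCosetQuot U α))
    (hbij' : Set.BijOn (fun j => ((a j : 𝒢) : 𝒢 ⧸ U')) Set.univ (ArithmeticQuotient.doubleCosetQuot U' α))
    (i : ℕ) :
    (resCohomology ι Δ τ hle i).hom ∘ₗ heckeCohomology ι Δ τ U' hU' hα i =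
      heckeCohomology ι Δ τ U hU hα i ∘ₗ (resCohomology ι Δ τ hle i).hom := by
  have h := congrArg ModuleCat.Hom.hom (resCohomology_heckeCohomology_of_bijOn ι Δ τ hU' hU hle hα
    (bijOn_quotientMapOfLE_of_bijOn hle a hbij hbij') i)
  rw [ModuleCat.hom_comp, ModuleCat.hom_comp] at h
  exact h.symm

end Cohomology

end LevelAction

end Literature.NumberTheory.Automorphic
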